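import Summits.HodgeConjecture.HodgeConjecture.Theorems.MarkmanPartnerTransportK3Sq2KugaSatakeSelfPresentationHK

/-!
# Route MarkmanPartnerTransport · support `PartnerTransport` (stmt-HodgeConjecture-19650) ∕ crux #5 —
# programme «KS-MIXED», step M2: ONE Kuga–Satake variety for a K3 SURFACE and a hyperkähler-type `X` presented on
# the same abstract Hodge structure — the two algebraic correspondences, GRANTED both Kuga–Satake statements

Varesco's Cor. 4.6 in the MIXED case (a transcendental Hodge similitude `T(S) ⥲ T(X)` between a projective surface
`S` with `h^{2,0} = 1` and a `2n`-dimensional `X`, e.g. a K3 surface and a `K3^{[2]}`-type PARTNER) starts, as in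
the equal-dimension cases already in the tree (gen 14 `…KugaSatakeSelfClassMap` §4 for one surface, gen 15
`…KugaSatakePairClassMap` for two surfaces, `…K3Sq2KugaSatakeSelfPresentationHK` §5 for one fourfold), from ONE
Kuga–Satake variety carrying both transcendental parts. The two Kuga–Satake records of the tree —
`HodgeTheory.IsKSCorrespondenceAlgebraicBetti hS` (surface, presentation `IsTranscendentalPartBetti`, sign `ε`) and
`Hyperkaehler.IsKSCorrespondenceAlgebraicHK n hX` (presentation `IsTranscendentalPartHK`, Fujiki form `b`) — quantify
over the IDENTICAL Clifford data `(e₁, e₂, κ_C; A, B, θ)` of the abstract polarized Hodge structure `(T, H, P)`, so a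
presentation of `S` on `(T, H, P)` and a presentation of `X` on `(T, H, d·P)` are served by the same abelian variety
`A` (vG §5–8 + Riemann: `exists_isKugaSatakeVarietyBetti_of_isOfK3Type'`), the Clifford data being transported along
`C⁺(dQ) ≅ C⁺(Q)` (gen 14's `…KugaSatakeSimilarTransport`):

* `exists_two_correspondences_of_kugaSatake_mixed` — GRANTED both statements: an injective class map
  `μ : T → H²((A × A)(ℂ); ℚ)` and maps `O_S : H²(S) → H²(A × A)`, `O_X : H²(X) → H²(A × A)` INDUCED BY ALGEBRAIC
  CYCLES with `O_S(j t ⊗ 1) = μ t ⊗ 1 = O_X(j' t ⊗ 1)` (`S` presented on `P`, `X` on `d·P`);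
* `exists_two_correspondences_of_kugaSatake_mixed'` — the same with `S` presented on `d·P` and `X` on `P`.

CONDITIONAL on the two Kuga–Satake hypotheses (both OPEN in print in general); THEOREMS ONLY; no sorry, no definition,
no new named fact; nothing here says HC or any item is proved. Prover seat hodge-nonav-19652-p1 (gen 15),
`--supports stmt-HodgeConjecture-19650` (blueprint «KS-MIXED», HOME/HANDOFF § 19652-p1 g15).

References: M. Varesco, Math. Z. 305 (2023) §4 (proof of Thm. 4.5), Cor. 4.6, Rem. 5.5; S. Floccari,
arXiv:2210.02948 §5.1; B. van Geemen (2000) §6.3, §10.2.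
-/

set_option linter.dupNamespace false

noncomputable section

namespace Summit.HodgeConjecture.HodgeConjecture.Theorems.MarkmanPartnerTransport.KugaSatakeHK

open scoped TensorProduct
open CategoryTheory MonoidalCategory Literature.AlgebraicGeometry Literature.AlgebraicGeometry.Motives
open Literature.AlgebraicGeometry.HodgeTheory Literature.AlgebraicTopology.SingularHomology
open Literature.AlgebraicGeometry.Motives.HodgeStructure Literature.AlgebraicGeometry.Hyperkaehler
open Summit.HodgeConjecture.HodgeConjecture.Theorems.MarkmanPartnerTransport.KugaSatakeSelf

/-- **ONE KUGA–SATAKE VARIETY FOR A SURFACE AND A HYPERKÄHLER-TYPE `X` — the two algebraic correspondences, GRANTED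
both Kuga–Satake statements.** Let `S` be a smooth projective surface with `IsKSCorrespondenceAlgebraicBetti hS`, `X`
smooth projective of dimension `2n` with `IsKSCorrespondenceAlgebraicHK n hX`, `(T, H, P, ε, j)` a presentation of
the transcendental part of `S` with `H` of K3 type, and `(T, H, d·P, j')` (`d > 0`) a presentation of the
transcendental part of `X` for the Fujiki form `b`. Then some complex abelian variety `A`, some INJECTIVE
`μ : T → H²((A × A)(ℂ); ℚ)` and maps `O_S`, `O_X` INDUCED BY ALGEBRAIC CYCLES on `(A × A) × S`, `(A × A) × X` satisfy
`O_S(j t ⊗ 1) = μ t ⊗ 1 = O_X(j' t ⊗ 1)` for all `t ∈ T`. CONDITIONAL on both Kuga–Satake hypotheses.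
[cite: Varesco2023, §4 (proof of Thm. 4.5), Cor. 4.6 and Rem. 5.5] [cite: Floccari2024, §5.1]
[cite: vanGeemen2000KugaSatakeHC, §6.3 and §10.2] -/
theorem exists_two_correspondences_of_kugaSatake_mixed {S X : SchemeOver ℂ} {n : ℕ}
    (hS : IsSmoothProjective 2 S) (hX : IsSmoothProjective (2 * n) X)
    (hKS : IsKSCorrespondenceAlgebraicBetti hS) (hKSX : IsKSCorrespondenceAlgebraicHK n hX)
    {M : HodgeModel 2 S} {hM : M.IsHodgeSymmetric} {M' : HodgeModel (2 * n) X} {hM' : M'.IsHodgeSymmetric}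
    {b : complexBetti X 2 →ₗ[ℂ] complexBetti X 2 →ₗ[ℂ] ℂ} (hb : IsFujikiForm n X b)
    {T : Type} [AddCommGroup T] [Module ℚ T] [Module.Finite ℚ T] {H : HodgeStructure T 2} {P : H.Polarization}
    {ε : ℤˣ} {j : H.Hom (bettiTwoHodgeStructure hS M hM)} (hj : IsTranscendentalPartBetti hS M hM H P ε j)
    (hK3 : H.IsOfK3Type) {d : ℚ} (hd : 0 < d) {j' : H.Hom (bettiTwoHodgeStructureOfModel hX M' hM')}
    (hj' : IsTranscendentalPartHK hX M' hM' b H (P.smul d hd) j') :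
    ∃ (A : AbelianVariety ℂ) (μ : T →ₗ[ℚ] bettiCohomology (A.X ⊗ A.X) 2)
      (O₁ : complexBetti S (2 * 1) →ₗ[ℂ] complexBetti (A.X ⊗ A.X) 2)
      (O₂ : complexBetti X (2 * 1) →ₗ[ℂ] complexBetti (A.X ⊗ A.X) 2),
      Function.Injective μ ∧
      IsAlgebraicCorrespondence (A.dim + A.dim) 2 (A.X ⊗ A.X) S O₁ ∧
      IsAlgebraicCorrespondence (A.dim + A.dim) (2 * n) (A.X ⊗ A.X) X O₂ ∧
      (∀ t : T, O₁ (ofRatClass (Motives.ComplexPoints S) (2 * 1) (j.toLinearMap t)) =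
        ofRatClass (Motives.ComplexPoints (A.X ⊗ A.X)) 2 (μ t)) ∧
      (∀ t : T, O₂ (ofRatClass (Motives.ComplexPoints X) (2 * 1) (j'.toLinearMap t)) =
        ofRatClass (Motives.ComplexPoints (A.X ⊗ A.X)) 2 (μ t)) := by
  have hT : H.hodgeNumber 2 0 = 1 := hK3.1
  -- van Geemen's data for `(T, H, P)` and ONE Kuga–Satake variety
  obtain ⟨e₁, e₂, h12, h1, h2⟩ := P.exists_orthogonal_pair_form_self_neg H hK3
  obtain ⟨κ, hκ⟩ := exists_isTensorEmbedding P hK3 h12 h1 h2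
  obtain ⟨A, B, hB, θ, hθ⟩ := Literature.AlgebraicGeometry.Surfaces.exists_isKugaSatakeVarietyBetti_of_isOfK3Type' H P hK3
  -- the surface, at `(T, H, P, ε, j)`
  obtain ⟨O₁, hO₁, hO₁j⟩ := hKS M hM T H P hT ε j hj e₁ e₂ h12 h1 h2 κ hκ A B hB θ hθ
  -- the `2n`-fold, at the transported data `(T, H, d·P, j')`
  obtain ⟨h12', h1', h2'⟩ := smul_pair_conditions P hd h12 h1 h2
  obtain ⟨O₂, hO₂, hO₂j⟩ := hKSX b hb M' hM' T H (P.smul d hd) hT j' hj' (d⁻¹ • e₁) e₂ h12' h1' h2' _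
    (isTensorEmbedding_transport P hd hκ) A B hB _ (isKugaSatakeVarietyBetti_transport P hd hT hθ)
  refine ⟨A, kugaSatakeClassMapBetti H P θ κ, O₁, O₂,
    kugaSatakeClassMapBetti_injective P A θ (isTensorEmbedding_injective P h1.ne hκ), hO₁, hO₂, hO₁j,
    fun t => ?_⟩
  rw [← kugaSatakeClassMapBetti_transport P hd θ κ t]
  exact hO₂j t

/-- **The same with the rôles of the scalings exchanged**: `S` presented on `(T, H, d·P, ε, j)` and `X` on
`(T, H, P, j')`. CONDITIONAL on both Kuga–Satake hypotheses. [cite: Varesco2023, §4 (proof of Thm. 4.5) and Cor. 4.6]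
[cite: vanGeemen2000KugaSatakeHC, §6.3 and §10.2] -/
theorem exists_two_correspondences_of_kugaSatake_mixed' {S X : SchemeOver ℂ} {n : ℕ}
    (hS : IsSmoothProjective 2 S) (hX : IsSmoothProjective (2 * n) X)
    (hKS : IsKSCorrespondenceAlgebraicBetti hS) (hKSX : IsKSCorrespondenceAlgebraicHK n hX)
    {M : HodgeModel 2 S} {hM : M.IsHodgeSymmetric} {M' : HodgeModel (2 * n) X} {hM' : M'.IsHodgeSymmetric}
    {b : complexBetti X 2 →ₗ[ℂ] complexBetti X 2 →ₗ[ℂ] ℂ} (hb : IsFujikiForm n X b)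
    {T : Type} [AddCommGroup T] [Module ℚ T] [Module.Finite ℚ T] {H : HodgeStructure T 2} {P : H.Polarization}
    (hK3 : H.IsOfK3Type) {j' : H.Hom (bettiTwoHodgeStructureOfModel hX M' hM')}
    (hj' : IsTranscendentalPartHK hX M' hM' b H P j') {d : ℚ} (hd : 0 < d)
    {ε : ℤˣ} {j : H.Hom (bettiTwoHodgeStructure hS M hM)} (hj : IsTranscendentalPartBetti hS M hM H (P.smul d hd) ε j) :
    ∃ (A : AbelianVariety ℂ) (μ : T →ₗ[ℚ] bettiCohomology (A.X ⊗ A.X) 2)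
      (O₁ : complexBetti X (2 * 1) →ₗ[ℂ] complexBetti (A.X ⊗ A.X) 2)
      (O₂ : complexBetti S (2 * 1) →ₗ[ℂ] complexBetti (A.X ⊗ A.X) 2),
      Function.Injective μ ∧
      IsAlgebraicCorrespondence (A.dim + A.dim) (2 * n) (A.X ⊗ A.X) X O₁ ∧
      IsAlgebraicCorrespondence (A.dim + A.dim) 2 (A.X ⊗ A.X) S O₂ ∧
      (∀ t : T, O₁ (ofRatClass (Motives.ComplexPoints X) (2 * 1) (j'.toLinearMap t)) =
        ofRatClass (Motives.ComplexPoints (A.X ⊗ A.X)) 2 (μ t)) ∧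
      (∀ t : T, O₂ (ofRatClass (Motives.ComplexPoints S) (2 * 1) (j.toLinearMap t)) =
        ofRatClass (Motives.ComplexPoints (A.X ⊗ A.X)) 2 (μ t)) := by
  have hT : H.hodgeNumber 2 0 = 1 := hK3.1
  obtain ⟨e₁, e₂, h12, h1, h2⟩ := P.exists_orthogonal_pair_form_self_neg H hK3
  obtain ⟨κ, hκ⟩ := exists_isTensorEmbedding P hK3 h12 h1 h2
  obtain ⟨A, B, hB, θ, hθ⟩ := Literature.AlgebraicGeometry.Surfaces.exists_isKugaSatakeVarietyBetti_of_isOfK3Type' H P hK3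
  -- the `2n`-fold, at `(T, H, P, j')`
  obtain ⟨O₁, hO₁, hO₁j⟩ := hKSX b hb M' hM' T H P hT j' hj' e₁ e₂ h12 h1 h2 κ hκ A B hB θ hθ
  -- the surface, at the transported data `(T, H, d·P, ε, j)`
  obtain ⟨h12', h1', h2'⟩ := smul_pair_conditions P hd h12 h1 h2
  obtain ⟨O₂, hO₂, hO₂j⟩ := hKS M hM T H (P.smul d hd) hT ε j hj (d⁻¹ • e₁) e₂ h12' h1' h2' _
    (isTensorEmbedding_transport P hd hκ) A B hB _ (isKugaSatakeVarietyBetti_transport P hd hT hθ)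
  refine ⟨A, kugaSatakeClassMapBetti H P θ κ, O₁, O₂,
    kugaSatakeClassMapBetti_injective P A θ (isTensorEmbedding_injective P h1.ne hκ), hO₁, hO₂, hO₁j,
    fun t => ?_⟩
  rw [← kugaSatakeClassMapBetti_transport P hd θ κ t]
  exact hO₂j t

end Summit.HodgeConjecture.HodgeConjecture.Theorems.MarkmanPartnerTransport.KugaSatakeHK

end
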